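import Summits.BirchSwinnertonDyer.Rank1Residual.X5.SelmerSolitaireQuadraticPolar
import HarnessLib

/-!
# Selmer solitaire, QUADRATIC-SPACE LAYER (ii‴) — Q4: the MOVE IS FORCED, `moveForced_holds : MoveForced` (QS2a)

Cell `b2b-bsdres`, O1 programme (p = 2), ORDER v2.9 pool slot (ii‴) (o1 lead GEN 20, R-G20.3/R-G20.4,
PLAN C150/C153), file Q4 of Q1 → Q2 → Q4 → Q5 (QS2a here; QS2b `moveIsExtension_holds` in the sequel
`…QuadraticMoveExtension.lean`, split off for the 400-line lint); pool hand x11b3-p4 GEN 5. Imports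
Q4a (`X5.SelmerSolitaireQuadraticPolar`).

HONEST FRAMING (cell, verbatim): research route; pure `𝔽₂` linear algebra — no curve, no Galois group,
no prime; nothing arithmetic asserted (the dictionary AR1–AR4 is NOT here); reach-neutral (R1 closes
no class); nothing booked; no mark / label / count moved; O1 OPEN. THEOREMS ONLY (no definition, no
named fact, no `sorry`).

## What is proved (lens-2 GEN 5 Prop B / GEN 10 2G10.2 QS2a; reserved name `moveForced_holds`)
`MoveForced : ∀ s U (ψ : QVec s →ₗ 𝔽₂), IsTSLagrangian U → ∃! L, IsTSLagrangian L ∧ K′_ψ ⊆ L ∧ u_q ∉ L`,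
`K′_ψ = {ι x + ψ(x) u_q : x ∈ U}` (`kPrime`). EXISTENCE: the candidate `L₀ = span(K′_ψ ∪ {y₀})` with
`y₀ = ι η + q(η) u_q + t_q` for any `η` with `⟨η, ·⟩ = ψ` (Q4a `polar_dualVec` supplies one): its
elements are exactly `ι x + ψ(x) u_q + c y₀` (`mem_span_kPrime_insert_iff`), in coordinates
`ι(x + cη) + (ψ x + c q(η), c)_q` (`comb_eq`); they are `q`-singular
(`qform_comb_eq_zero`: `q = c q(η) + c⟨x,η⟩ + (ψx + c qη)c = 2c ψ(x) = 0`), `dim L₀ = dim U + 1 = |D| + 2`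
(`finrank_span_kPrime_insert`, injective parametrisation by `U × 𝔽₂`), `K′ ⊆ L₀`, `u_q ∉ L₀`
(`uNew_ne_comb`). UNIQUENESS (`eq_span_of_isTSLagrangian`): for a totally singular Lagrangian `L ⊇ K′`
with `u_q ∉ L`, write `y ∈ L` as `ι x + (a,b)_q`; pairing with `K′ ⊆ L` gives `⟨x, ·⟩|_U = b ψ`; if
`b = 0` then `x ∈ U` by SELF-ORTHOGONALITY of `U` (Q4a `mem_of_forall_polar_eq_zero`) and `a = ψ(x)`
(else `u_q ∈ L`), so `y ∈ K′`; if `b = 1` then `x + η ∈ U`, and `q(y) = 0` pins `a = ψ(x+η) + q(η)`, so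
`y = y₀ + (ι u + ψ(u) u_q)`, `u = x + η`; hence `L ≤ L₀`, and the dimensions agree. So of the two totally
singular Lagrangians over `K′` (a hyperbolic plane `K′^⊥/K′` has two singular lines, `u_q` spans one)
EXACTLY ONE avoids `u_q` — the arithmetic reading '`K_D = 0` excludes `u_q`, so the localisation image
at level `D ∪ q` is determined by `ψ = loc_q|`' is NOT asserted here. Executable evidence (lens-2 GEN
10, EVIDENCE only): `code/qs_layer_check.py`, `QS2a_moves 4320`, 0 violations at `|D| = 3`.
END: `moveForced_at` (pointwise form), **`moveForced_holds : MoveForced`**.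

## References
* lens-2 GEN 5 G5.1 Prop B, GEN 10 2G10.2 (`cells/o1/ROUTES-O1.md` l.1966–1988); B. Poonen, E. Rains,
  JAMS 25 (2012), §4 Prop. 4.10 / 4.12 (the local spaces and their singular maximal isotropic subspaces)
  [PoonenRains2012]; B. Mazur, K. Rubin, Contemp. Math. 358 (2004), §5 [MazurRubin2004Intro].
* Tree dedup: `lean search 'moveForced_holds|kPrime_insert|comb_eq'` → reservations only.
-/

namespace Summit.BirchSwinnertonDyer.Rank1Residual.X5.SelmerSolitaire.Quadratic

open Finset Matrix SelmerSolitaire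

variable {s : ℕ}

/-- Membership in the span of `K′_ψ ∪ {y₀}`: exactly the vectors `ι x + ψ(x) u_q + c y₀`, `x ∈ U`.
[folklore] -/
theorem mem_span_kPrime_insert_iff (U : Submodule (ZMod 2) (QVec s)) (ψ : QVec s →ₗ[ZMod 2] ZMod 2)
    (y₀ : QVec (s + 1)) (y : QVec (s + 1)) :
    y ∈ Submodule.span (ZMod 2) (insert y₀ (kPrime U ψ)) ↔
      ∃ x ∈ U, ∃ c : ZMod 2, y = iota x + ψ x • uNew s + c • y₀ := by
  constructor
  · intro hy
    induction hy using Submodule.span_induction with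
    | mem z hz =>
      rcases hz with rfl | ⟨x, hx, rfl⟩
      · exact ⟨0, U.zero_mem, 1, by simp⟩
      · exact ⟨x, hx, 0, by simp⟩
    | zero => exact ⟨0, U.zero_mem, 0, by simp⟩
    | add y y' _ _ hy hy' =>
      obtain ⟨x, hx, c, rfl⟩ := hy
      obtain ⟨x', hx', c', rfl⟩ := hy'
      refine ⟨x + x', U.add_mem hx hx', c + c', ?_⟩
      rw [iota_add, map_add, add_smul, add_smul]; abel
    | smul a y _ hy =>
      obtain ⟨x, hx, c, rfl⟩ := hy
      refine ⟨a • x, U.smul_mem a hx, a * c, ?_⟩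
      rw [iota_smul, map_smul, smul_eq_mul, mul_smul, mul_smul, smul_add, smul_add]
  · rintro ⟨x, hx, c, rfl⟩
    refine Submodule.add_mem _ (Submodule.subset_span (Set.mem_insert_of_mem _ ⟨x, hx, rfl⟩))
      (Submodule.smul_mem _ c (Submodule.subset_span (Set.mem_insert _ _)))

/-- Normal form of `ι x + a u_q + c (ι η + p_q)`: old part `x + c η`, new coordinates
`(a + c p₁, c p₂)`. [folklore] -/
theorem comb_eq (x η : QVec s) (a c : ZMod 2) (p : ZMod 2 × ZMod 2) :
    iota x + a • uNew s + c • (iota η + Pi.single (some (Fin.last s)) p) =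
      iota (x + c • η) + Pi.single (some (Fin.last s)) ((a + c * p.1, c * p.2) : ZMod 2 × ZMod 2) := by
  rw [smul_add, iota_add, iota_smul, smul_uNew, ← Pi.single_smul,
    show ((a + c * p.1, c * p.2) : ZMod 2 × ZMod 2) = (a, 0) + c • p by ext <;> simp, Pi.single_add]
  abel

/-- The new coordinates of `ι x + p_q` are `p`. [folklore] -/
@[simp] theorem iota_add_single_apply_new (x : QVec s) (p : ZMod 2 × ZMod 2) :
    (iota x + Pi.single (some (Fin.last s)) p : QVec (s + 1)) (some (Fin.last s)) = p := by
  simp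

/-- The old coordinates of `ι x + p_q` are those of `x`. [folklore] -/
@[simp] theorem iota_add_single_apply_oldV (x : QVec s) (p : ZMod 2 × ZMod 2) (v : V s) :
    (iota x + Pi.single (some (Fin.last s)) p : QVec (s + 1)) (oldV v) = x v := by
  simp

/-- `ι x + p_q = ι x' + p'_q` iff `x = x'` and `p = p'`. [folklore] -/
theorem iota_add_single_inj {x x' : QVec s} {p p' : ZMod 2 × ZMod 2}
    (h : iota x + Pi.single (some (Fin.last s)) p = iota x' + Pi.single (some (Fin.last s)) p') :
    x = x' ∧ p = p' := by
  refine ⟨funext fun v => ?_, ?_⟩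
  · simpa using congrFun h (oldV v)
  · simpa using congrFun h (some (Fin.last s))

/-- **Total singularity of the candidate Lagrangian**: for `x ∈ U` (totally singular), `η` with
`⟨η, ·⟩ = ψ` and any `c`, `q(ι x + ψ(x) u_q + c·y₀) = 0` where `y₀ = ι η + (q(η), 1)_q` (lens-2 GEN 5
Prop B: the second singular line of the hyperbolic plane `K′^⊥/K′`). [cite: PoonenRains2012, §4 (Prop. 4.10)] -/
theorem qform_comb_eq_zero {U : Submodule (ZMod 2) (QVec s)} (hU : ∀ x ∈ U, qform x = 0)
    (ψ : QVec s →ₗ[ZMod 2] ZMod 2) {η : QVec s} (hη : ∀ y, polar η y = ψ y) {x : QVec s} (hx : x ∈ U)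
    (c : ZMod 2) :
    qform (iota x + ψ x • uNew s +
      c • (iota η + Pi.single (some (Fin.last s)) ((qform η, 1) : ZMod 2 × ZMod 2))) = 0 := by
  rw [comb_eq, qform_iota_add_single, NF.qform_add, qform_smul, polar_smul_right, polar_comm x, hη x,
    hU x hx]
  have key : ∀ a b c : ZMod 2, 0 + c * b + c * a + (a + c * b) * (c * 1) = 0 := by decide
  exact key _ _ _

/-- `u_q` is never of the form `ι x + ψ(x) u_q + c (ι η + p_q)` with `p₂ = 1`: comparing new
coordinates forces `c = 0`, then old coordinates force `x = 0`, and then `ψ x = 0 ≠ 1`. [folklore] -/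
theorem uNew_ne_comb (ψ : QVec s →ₗ[ZMod 2] ZMod 2) (η x : QVec s) (c : ZMod 2)
    (p : ZMod 2 × ZMod 2) (hp : p.2 = 1) :
    uNew s ≠ iota x + ψ x • uNew s + c • (iota η + Pi.single (some (Fin.last s)) p) := by
  intro h
  rw [comb_eq, uNew_eq_single, ← zero_add (Pi.single _ _), ← iota_zero] at h
  obtain ⟨hx0, hp0⟩ := iota_add_single_inj h
  have hc : c = 0 := by have := congrArg Prod.snd hp0; simp [hp] at this; exact this.symm
  rw [hc, zero_smul, add_zero] at hx0
  have := congrArg Prod.fst hp0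
  rw [← hx0, map_zero, hc] at this
  simp at this

/-- In an `𝔽₂`-space `z + z = 0`. [folklore] -/
theorem add_self_qvec (z : QVec s) : z + z = 0 := by
  rw [← two_smul (ZMod 2) z, show (2 : ZMod 2) = 0 from rfl, zero_smul]

/-- **Dimension of the candidate Lagrangian** `span(K′_ψ ∪ {y₀})`: it is the image of the injective
linear map `(u, c) ↦ ι u + ψ(u) u_q + c y₀` on `U × 𝔽₂`, so its dimension is `dim U + 1 = |D| + 2`.
[folklore] -/
theorem finrank_span_kPrime_insert {U : Submodule (ZMod 2) (QVec s)} (hU : IsTSLagrangian U)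
    (ψ : QVec s →ₗ[ZMod 2] ZMod 2) (η : QVec s) :
    Module.finrank (ZMod 2) ↥(Submodule.span (ZMod 2)
      (insert (iota η + Pi.single (some (Fin.last s)) ((qform η, 1) : ZMod 2 × ZMod 2)) (kPrime U ψ))) =
      s + 2 := by
  set y₀ : QVec (s + 1) := iota η + Pi.single (some (Fin.last s)) ((qform η, 1) : ZMod 2 × ZMod 2)
    with hy₀
  let Φ : (↥U × ZMod 2) →ₗ[ZMod 2] QVec (s + 1) :=
    { toFun := fun uc => iota (uc.1 : QVec s) + ψ (uc.1 : QVec s) • uNew s + uc.2 • y₀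
      map_add' := fun uc uc' => by
        simp only [Prod.fst_add, Prod.snd_add, Submodule.coe_add, iota_add, map_add, add_smul]
        abel
      map_smul' := fun a uc => by
        simp only [Prod.smul_fst, Prod.smul_snd, Submodule.coe_smul, iota_smul, map_smul,
          smul_eq_mul, mul_smul, RingHom.id_apply, smul_add] }
  have hrange : LinearMap.range Φ = Submodule.span (ZMod 2) (insert y₀ (kPrime U ψ)) := by
    ext y
    rw [LinearMap.mem_range, mem_span_kPrime_insert_iff]
    constructor
    · rintro ⟨uc, rfl⟩; exact ⟨uc.1, uc.1.2, uc.2, rfl⟩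
    · rintro ⟨x, hx, c, rfl⟩; exact ⟨(⟨x, hx⟩, c), rfl⟩
  have hinj : Function.Injective Φ := by
    rintro ⟨u, c⟩ ⟨u', c'⟩ h
    change iota (u : QVec s) + ψ (u : QVec s) • uNew s + c • y₀ =
      iota (u' : QVec s) + ψ (u' : QVec s) • uNew s + c' • y₀ at h
    rw [hy₀, comb_eq, comb_eq] at h
    obtain ⟨hold, hnew⟩ := iota_add_single_inj h
    have hc : c = c' := by simpa using congrArg Prod.snd hnew
    subst hc
    have hu : (u : QVec s) = u' := add_right_cancel hold
    exact Prod.ext (Subtype.ext hu) rfl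
  rw [← hrange, LinearMap.finrank_range_of_inj hinj, Module.finrank_prod, Module.finrank_self, hU.2]

/-- **The candidate is a totally singular Lagrangian of `Q_{D ∪ q}`.** [cite: PoonenRains2012, §4 (Prop. 4.10)] -/
theorem isTSLagrangian_span_kPrime_insert {U : Submodule (ZMod 2) (QVec s)} (hU : IsTSLagrangian U)
    (ψ : QVec s →ₗ[ZMod 2] ZMod 2) {η : QVec s} (hη : ∀ y, polar η y = ψ y) :
    IsTSLagrangian (Submodule.span (ZMod 2)
      (insert (iota η + Pi.single (some (Fin.last s)) ((qform η, 1) : ZMod 2 × ZMod 2)) (kPrime U ψ))) := by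
  refine ⟨fun y hy => ?_, finrank_span_kPrime_insert hU ψ η⟩
  obtain ⟨x, hx, c, rfl⟩ := (mem_span_kPrime_insert_iff U ψ _ y).mp hy
  exact qform_comb_eq_zero hU.1 ψ hη hx c

/-- `K′_ψ ⊆` the candidate. [folklore] -/
theorem kPrime_subset_span (U : Submodule (ZMod 2) (QVec s)) (ψ : QVec s →ₗ[ZMod 2] ZMod 2)
    (y₀ : QVec (s + 1)) :
    kPrime U ψ ⊆ (Submodule.span (ZMod 2) (insert y₀ (kPrime U ψ)) : Set (QVec (s + 1))) :=
  fun _ hy => Submodule.subset_span (Set.mem_insert_of_mem _ hy)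

/-- `u_q ∉` the candidate. [folklore] -/
theorem uNew_not_mem_span (U : Submodule (ZMod 2) (QVec s)) (ψ : QVec s →ₗ[ZMod 2] ZMod 2)
    (η : QVec s) :
    uNew s ∉ Submodule.span (ZMod 2)
      (insert (iota η + Pi.single (some (Fin.last s)) ((qform η, 1) : ZMod 2 × ZMod 2)) (kPrime U ψ)) := by
  intro h
  obtain ⟨x, -, c, hc⟩ := (mem_span_kPrime_insert_iff U ψ _ _).mp h
  exact uNew_ne_comb ψ η x c (qform η, 1) rfl hc

/-- **Uniqueness (lens-2 GEN 5 Prop B)**: any totally singular Lagrangian `L` of `Q_{D ∪ q}` containing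
`K′_ψ` and avoiding `u_q` is the candidate `span(K′_ψ ∪ {y₀})`. The vectors of `L` with `t_q`-coordinate
`0` lie in `K′` (self-orthogonality of `U` and `u_q ∉ L`); a vector with `t_q`-coordinate `1` is
`y₀` modulo `K′` (self-orthogonality again, and `q = 0` fixes the `u_q`-coordinate); dimensions agree.
[cite: PoonenRains2012, §4 (Prop. 4.10)] -/
theorem eq_span_of_isTSLagrangian {U : Submodule (ZMod 2) (QVec s)} (hU : IsTSLagrangian U)
    (ψ : QVec s →ₗ[ZMod 2] ZMod 2) {η : QVec s} (hη : ∀ y, polar η y = ψ y)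
    {L : Submodule (ZMod 2) (QVec (s + 1))} (hL : IsTSLagrangian L)
    (hKL : kPrime U ψ ⊆ (L : Set (QVec (s + 1)))) (huL : uNew s ∉ L) :
    L = Submodule.span (ZMod 2)
      (insert (iota η + Pi.single (some (Fin.last s)) ((qform η, 1) : ZMod 2 × ZMod 2)) (kPrime U ψ)) := by
  have hiso : ∀ y ∈ L, ∀ y' ∈ L, polar y y' = 0 := fun y hy y' hy' =>
    NF.polar_eq_zero_of_mem hL.1 hy hy'
  have hle : L ≤ Submodule.span (ZMod 2) (insert (iota η + Pi.single (some (Fin.last s))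
      ((qform η, 1) : ZMod 2 × ZMod 2)) (kPrime U ψ)) := by
    intro y hy
    rw [mem_span_kPrime_insert_iff]
    -- decompose `y = ι x + p_q`
    have hyd := eq_iota_add_single y
    set x : QVec s := fun v => y (oldV v) with hxdef
    set p : ZMod 2 × ZMod 2 := y (some (Fin.last s)) with hpdef
    -- pairing with `K′ ⊆ L`
    have hpair : ∀ x' ∈ U, polar x x' = p.2 * ψ x' := by
      intro x' hx'
      have h := hiso y hy _ (hKL ⟨x', hx', rfl⟩)
      rw [hyd, iota_add_smul_uNew, polar_iota_add_single, mul_zero, zero_add] at h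
      exact NF.zmod2_add_eq_zero_iff.mp h
    rcases (by decide : ∀ c : ZMod 2, c = 0 ∨ c = 1) p.2 with hp2 | hp2
    · -- `t_q`-coordinate `0`: `y ∈ K′`
      have hxU : x ∈ U := mem_of_forall_polar_eq_zero hU fun x' hx' => by
        rw [hpair x' hx', hp2, zero_mul]
      have hk : iota x + ψ x • uNew s ∈ L := hKL ⟨x, hxU, rfl⟩
      have hdiff : y - (iota x + ψ x • uNew s) = (p.1 - ψ x) • uNew s := by
        rw [iota_add_smul_uNew, smul_uNew, hyd, add_sub_add_left_eq_sub, ← Pi.single_sub]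
        congr 1
        ext <;> simp [hp2]
      by_cases h1 : p.1 = ψ x
      · refine ⟨x, hxU, 0, ?_⟩
        rw [zero_smul, add_zero]
        have : y - (iota x + ψ x • uNew s) = 0 := by rw [hdiff, h1, sub_self, zero_smul]
        exact sub_eq_zero.mp this
      · exfalso
        have hne : p.1 - ψ x ≠ 0 := sub_ne_zero.mpr h1
        have h1' : p.1 - ψ x = 1 := (by decide : ∀ c : ZMod 2, c ≠ 0 → c = 1) _ hne
        rw [h1', one_smul] at hdiff
        exact huL (hdiff ▸ L.sub_mem hy hk)
    · -- `t_q`-coordinate `1`: `y = y₀ + (element of K′)`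
      have huU : x + η ∈ U := mem_of_forall_polar_eq_zero hU fun x' hx' => by
        rw [polar_add_left, hpair x' hx', hp2, one_mul, hη, CharTwo.add_self_eq_zero]
      have hq : qform y = 0 := hL.1 y hy
      rw [hyd, qform_iota_add_single, hp2, mul_one, NF.zmod2_add_eq_zero_iff] at hq
      -- `u := x + η ∈ U`, `x = u + η`, and `q(y) = 0` pins the `u_q`-coordinate
      have hx : x = (x + η) + η := by rw [add_assoc, add_self_qvec, add_zero]
      have hp1 : p.1 = ψ (x + η) + qform η := by
        rw [← hq]
        conv_lhs => rw [hx]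
        rw [NF.qform_add, hU.1 _ huU, zero_add, polar_comm, hη, add_comm]
      refine ⟨x + η, huU, 1, ?_⟩
      calc y = iota x + Pi.single (some (Fin.last s)) p := hyd
        _ = iota x + Pi.single (some (Fin.last s)) ((ψ (x + η) + qform η, 1) : ZMod 2 × ZMod 2) := by
          rw [show p = (ψ (x + η) + qform η, 1) from Prod.ext hp1 hp2]
        _ = iota (x + η) + ψ (x + η) • uNew s +
              (1 : ZMod 2) • (iota η + Pi.single (some (Fin.last s)) ((qform η, 1) : ZMod 2 × ZMod 2)) := by
          rw [comb_eq, one_smul, one_mul, one_mul, ← hx]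
  refine Submodule.eq_of_le_of_finrank_eq hle ?_
  rw [hL.2, finrank_span_kPrime_insert hU ψ η]

/-- **QS2a `MoveForced` (lens-2 GEN 5 Prop B / GEN 10 2G10.2)**: for every totally singular Lagrangian
`U` of `Q_D` and every linear functional `ψ`, among the totally singular Lagrangians of `Q_{D ∪ q}`
containing `K′_ψ = {ι x + ψ(x) u_q}` there is EXACTLY ONE not containing `u_q`, namely
`K′_ψ ⊕ ⟨ι η + q(η) u_q + t_q⟩` for any `η` with `⟨η, ·⟩ = ψ`. (Arithmetic reading, NOT asserted here:
`K_D = 0` excludes `u_q`, so the localisation image at level `D ∪ q` is determined by `ψ = loc_q|`.)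
[cite: PoonenRains2012, §4 (Prop. 4.10)] -/
theorem moveForced_at (U : Submodule (ZMod 2) (QVec s)) (ψ : QVec s →ₗ[ZMod 2] ZMod 2)
    (hU : IsTSLagrangian U) :
    ∃! L : Submodule (ZMod 2) (QVec (s + 1)),
      IsTSLagrangian L ∧ kPrime U ψ ⊆ (L : Set (QVec (s + 1))) ∧ uNew s ∉ L := by
  have hη := polar_dualVec ψ
  exact ExistsUnique.intro _
    ⟨isTSLagrangian_span_kPrime_insert hU ψ hη, kPrime_subset_span U ψ _, uNew_not_mem_span U ψ _⟩
    fun _ hL => eq_span_of_isTSLagrangian hU ψ hη hL.1 hL.2.1 hL.2.2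

/-- **QS2a `MoveForced`** as the reserved word-shape. [cite: PoonenRains2012, §4 (Prop. 4.10)] -/
theorem moveForced_holds : SelmerSolitaire.Quadratic.MoveForced := fun _ U ψ hU =>
  moveForced_at U ψ hU

end Summit.BirchSwinnertonDyer.Rank1Residual.X5.SelmerSolitaire.Quadratic
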